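import Literature.Analysis.FluidPDE.PassiveVectorTensorTransverseKernel
import Literature.Analysis.FluidPDE.SobolevChangeOfVariablesMeasurePreserving
import HarnessLib

/-!
# Twisted coercivity: the energy form of the conjugated tensor `𝔸^G` versus that of `𝔸` for a frame
# `G` near the identity (pointwise algebra)

Analysis/FluidPDE proof-support file (everything proved; no definitions, no named facts).

For a fourth-order viscosity tensor `𝔸` (`Torus.Visc4`) and a matrix `G`, the conjugated tensor
`(𝔸^G)_{icje} = Σ_{a,b} G_{ca} 𝔸_{iajb} G_{eb}` (`Torus.Visc4.conj`) is the distortion of the diffusion by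
the inverse flow gradient in Lagrangian coordinates (Armstrong–Vicol, §4.1, PDF p. 34; Giaquinta, Ch. III
§2 (2.1)–(2.3) for divergence-form systems under changes of variables). Its energy form on a gradient
matrix `ξ` is the energy form of `𝔸` on the TWISTED gradient `(ξ·G)_{ia} = Σ_c G_{ca} ξ_{ic}`
(`gradForm_conj_eq`, from the tree's `Visc4.sum_conj_mul_mul_eq`). Consequently, for a frame
`θ`-close to the identity ENTRYWISE, `|G_{ca} − δ_{ca}| ≤ θ`, and a tensor with full bilinear bound
`Torus.FullBound 𝔸 h`:

* `sum_sq_twist_sub_le` — `‖ξ·(G − 1)‖_F² ≤ (card d · θ)² ‖ξ‖_F²`;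
* `abs_gradForm_conj_sub_le` — **`|gradForm 𝔸^G ξ − gradForm 𝔸 ξ| ≤ h·(2 dθ + (dθ)²)·‖ξ‖_F²`**
  (`d = card d`, `‖ξ‖_F² = Σ_{i,a} ξ_{ia}²`);
* `gradForm_conj_ge_of_floor` / `gradForm_conj_le_of_floor` — the RELATIVE form under any pointwise floor
  `λ‖ξ‖_F² ≤ gradForm 𝔸 ξ` (`λ > 0`): `(1 − ε/λ)·gradForm 𝔸 ξ ≤ gradForm 𝔸^G ξ ≤ (1 + ε/λ)·gradForm 𝔸 ξ`,
  `ε = h(2dθ + (dθ)²)` — the «twisted coercivity» `(1 − Cθ) D_1 ≤ D_G ≤ (1 + Cθ) D_1` of the `ad-ideate`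
  cell's WANTED #3 (E2), pointwise in `(t, y)`, hence for the integrated dissipations by monotonicity;
* `gradForm_conj_isoVisc_ge` / `_le` — the scalar-viscosity instance (`𝔸 = isoVisc ν`, floor `λ = ν`,
  `h = (card d)² ν`).

CAVEAT (stated for the consumers): `Torus.NearIso` is a TRANSVERSE (Legendre–Hadamard) condition and gives
no pointwise floor; a pointwise floor holds for `isoVisc ν` and for tensors with a definite full form. On
`G`-solenoidal (not flat-solenoidal) fields the Fourier-side floor needs a separate `O(θ)` Helmholtz
correction, not in this file.

## References
* S. Armstrong, V. Vicol, *Anomalous diffusion by fractal homogenization*, Ann. PDE (2025), §4.1, PDF p. 34.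
  [`ArmstrongVicol2025`]
* M. Giaquinta, *Multiple integrals in the calculus of variations and nonlinear elliptic systems* (1983),
  Ch. III §2 (2.1)–(2.3). [`Giaquinta1983MultipleIntegrals`]
-/

noncomputable section

open Finset

namespace Literature.Analysis.FluidPDE.Torus

variable {d : Type*} [Fintype d] [DecidableEq d]

/-! ## §1 The energy form of the conjugated tensor is the energy form on the twisted gradient -/

omit [DecidableEq d] in
/-- **`gradForm 𝔸^G ξ = gradForm 𝔸 (ξ·G)`**, `(ξ·G)_{ia} = Σ_c G_{ca} ξ_{ic}` (the diagonal of
`Visc4.sum_conj_mul_mul_eq`). [cite: Giaquinta1983MultipleIntegrals, Ch. III §2 eq. (2.1)-(2.3)]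
[cite: ArmstrongVicol2025, §4.1 (s_{m−1}, T_{m−1}), PDF p. 34] -/
theorem gradForm_conj_eq (G : Matrix d d ℝ) (𝔸 : Visc4 d) (ξ : d → d → ℝ) :
    gradForm (Visc4.conj G 𝔸) ξ = gradForm 𝔸 (fun i a => ∑ c, G c a * ξ i c) := by
  rw [gradForm_eq_sum_mul_mul, gradForm_eq_sum_mul_mul, Visc4.sum_conj_mul_mul_eq]

omit [Fintype d] in
/-- Twisting by the identity does nothing: `Σ_c δ_{ca} ξ_{ic} = ξ_{ia}`. [cite: Giaquinta1983MultipleIntegrals, Ch. III §2 eq. (2.1)-(2.3)] -/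
theorem sum_one_mul_eq [Fintype d] (ξ : d → d → ℝ) (i a : d) : ∑ c, (1 : Matrix d d ℝ) c a * ξ i c = ξ i a := by
  simp [Matrix.one_apply]

omit [DecidableEq d] in
/-- Polarisation of the energy form: `gradForm 𝔸 (ξ + δ) − gradForm 𝔸 ξ = 𝔸:ξ:δ + 𝔸:δ:ξ + 𝔸:δ:δ`.
[cite: Giaquinta1983MultipleIntegrals, Ch. III §2 eq. (2.1)-(2.3)] -/
theorem gradForm_add_sub (𝔸 : Visc4 d) (ξ δ : d → d → ℝ) :
    gradForm 𝔸 (fun i a => ξ i a + δ i a) - gradForm 𝔸 ξ =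
      (∑ i, ∑ a, ∑ j, ∑ b, 𝔸 i a j b * ξ i a * δ j b) + (∑ i, ∑ a, ∑ j, ∑ b, 𝔸 i a j b * δ i a * ξ j b) +
        ∑ i, ∑ a, ∑ j, ∑ b, 𝔸 i a j b * δ i a * δ j b := by
  simp only [gradForm, ← Finset.sum_add_distrib, ← Finset.sum_sub_distrib]
  refine Finset.sum_congr rfl fun i _ => Finset.sum_congr rfl fun a _ => Finset.sum_congr rfl fun j _ =>
    Finset.sum_congr rfl fun b _ => ?_
  ring

/-! ## §2 The twisted gradient of a frame near the identity -/

omit [DecidableEq d] in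
/-- **`‖ξ·E‖_F² ≤ (card d · θ)² ‖ξ‖_F²`** for `|E_{ca}| ≤ θ` entrywise (Cauchy–Schwarz in `c`).
[cite: Giaquinta1983MultipleIntegrals, Ch. III §2 eq. (2.1)-(2.3)] -/
theorem sum_sq_twist_le {E : Matrix d d ℝ} {θ : ℝ} (hE : ∀ c a, |E c a| ≤ θ) (ξ : d → d → ℝ) :
    ∑ i, ∑ a, (∑ c, E c a * ξ i c) ^ 2 ≤ (Fintype.card d * θ) ^ 2 * ∑ i, ∑ a, ξ i a ^ 2 := by
  have hrow : ∀ i a, (∑ c, E c a * ξ i c) ^ 2 ≤ θ ^ 2 * (Fintype.card d * ∑ c, ξ i c ^ 2) := by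
    intro i a
    have h1 : |∑ c, E c a * ξ i c| ≤ θ * ∑ c, |ξ i c| := by
      refine (Finset.abs_sum_le_sum_abs _ _).trans ?_
      rw [Finset.mul_sum]
      exact Finset.sum_le_sum fun c _ => by rw [abs_mul]; exact mul_le_mul_of_nonneg_right (hE c a) (abs_nonneg _)
    have h2 : (∑ c, |ξ i c|) ^ 2 ≤ Fintype.card d * ∑ c, ξ i c ^ 2 := by
      have h := sq_sum_le_card_mul_sum_sq (s := (Finset.univ : Finset d)) (f := fun c => |ξ i c|)
      simp only [Finset.card_univ, sq_abs] at h
      exact h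
    have h3 : (∑ c, E c a * ξ i c) ^ 2 ≤ (θ * ∑ c, |ξ i c|) ^ 2 := by
      rw [← sq_abs (∑ c, E c a * ξ i c)]
      exact pow_le_pow_left₀ (abs_nonneg _) h1 2
    calc (∑ c, E c a * ξ i c) ^ 2 ≤ (θ * ∑ c, |ξ i c|) ^ 2 := h3
      _ = θ ^ 2 * (∑ c, |ξ i c|) ^ 2 := by ring
      _ ≤ θ ^ 2 * (Fintype.card d * ∑ c, ξ i c ^ 2) := mul_le_mul_of_nonneg_left h2 (sq_nonneg _)
  calc ∑ i, ∑ a, (∑ c, E c a * ξ i c) ^ 2 ≤ ∑ i, ∑ _a : d, θ ^ 2 * (Fintype.card d * ∑ c, ξ i c ^ 2) :=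
        Finset.sum_le_sum fun i _ => Finset.sum_le_sum fun a _ => hrow i a
    _ = (Fintype.card d * θ) ^ 2 * ∑ i, ∑ a, ξ i a ^ 2 := by
        simp only [Finset.sum_const, Finset.card_univ, nsmul_eq_mul, Finset.mul_sum]
        refine Finset.sum_congr rfl fun i _ => Finset.sum_congr rfl fun c _ => ?_
        ring

/-! ## §3 The comparison -/

/-- **Twisted coercivity, absolute form**: for `FullBound 𝔸 h` and a frame with `|G_{ca} − δ_{ca}| ≤ θ`,
`|gradForm 𝔸^G ξ − gradForm 𝔸 ξ| ≤ h (2 dθ + (dθ)²) ‖ξ‖_F²` (`d = card d`).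
[cite: Giaquinta1983MultipleIntegrals, Ch. III §2 eq. (2.1)-(2.3)] [cite: ArmstrongVicol2025, §4.1 (s_{m−1}, T_{m−1}), PDF p. 34] -/
theorem abs_gradForm_conj_sub_le {𝔸 : Visc4 d} {h : ℝ} (hB : FullBound 𝔸 h) (hh : 0 ≤ h) {G : Matrix d d ℝ}
    {θ : ℝ} (hθ : 0 ≤ θ) (hG : ∀ c a, |G c a - (1 : Matrix d d ℝ) c a| ≤ θ) (ξ : d → d → ℝ) :
    |gradForm (Visc4.conj G 𝔸) ξ - gradForm 𝔸 ξ| ≤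
      h * (2 * (Fintype.card d * θ) + (Fintype.card d * θ) ^ 2) * ∑ i, ∑ a, ξ i a ^ 2 := by
  -- the twisted gradient is `ξ + δ`, `δ = ξ·(G − 1)`
  set δ : d → d → ℝ := fun i a => ∑ c, (G - 1) c a * ξ i c with hδ
  have htw : (fun i a => ∑ c, G c a * ξ i c) = fun i a => ξ i a + δ i a := by
    funext i a
    rw [hδ]
    simp only [Matrix.sub_apply, sub_mul, Finset.sum_sub_distrib, sum_one_mul_eq]
    ring
  rw [gradForm_conj_eq, htw]
  -- Frobenius norms
  set Nξ : ℝ := ∑ i, ∑ a, ξ i a ^ 2 with hNξ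
  set Nδ : ℝ := ∑ i, ∑ a, δ i a ^ 2 with hNδ
  have hNξ0 : 0 ≤ Nξ := Finset.sum_nonneg fun _ _ => Finset.sum_nonneg fun _ _ => sq_nonneg _
  have hNδ0 : 0 ≤ Nδ := Finset.sum_nonneg fun _ _ => Finset.sum_nonneg fun _ _ => sq_nonneg _
  have hfrob : ∀ ζ : d → d → ℝ, Real.sqrt (gradForm (isoVisc 1 : Visc4 d) ζ) = Real.sqrt (∑ i, ∑ a, ζ i a ^ 2) := by
    intro ζ; rw [gradForm_isoVisc, one_mul]
  have hNδle : Nδ ≤ (Fintype.card d * θ) ^ 2 * Nξ :=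
    sum_sq_twist_le (fun c a => by simpa [Matrix.sub_apply] using hG c a) ξ
  have hsq : Real.sqrt Nδ ≤ Fintype.card d * θ * Real.sqrt Nξ := by
    rw [← Real.sqrt_sq (by positivity : (0 : ℝ) ≤ Fintype.card d * θ), ← Real.sqrt_mul (sq_nonneg _)]
    exact Real.sqrt_le_sqrt hNδle
  -- the three polarisation terms
  have h1 := hB ξ δ
  have h2 := hB δ ξ
  have h3 := hB δ δ
  simp only [hfrob] at h1 h2 h3
  simp only [← hNξ, ← hNδ] at h1 h2 h3
  rw [gradForm_add_sub]
  have hx : Real.sqrt Nξ * Real.sqrt Nξ = Nξ := Real.mul_self_sqrt hNξ0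
  have hy : Real.sqrt Nδ * Real.sqrt Nδ = Nδ := Real.mul_self_sqrt hNδ0
  have hsx : 0 ≤ Real.sqrt Nξ := Real.sqrt_nonneg _
  have e1 : h * Real.sqrt Nξ * Real.sqrt Nδ ≤ h * (Fintype.card d * θ) * Nξ := by
    calc h * Real.sqrt Nξ * Real.sqrt Nδ ≤ h * Real.sqrt Nξ * (Fintype.card d * θ * Real.sqrt Nξ) :=
          mul_le_mul_of_nonneg_left hsq (mul_nonneg hh hsx)
      _ = h * (Fintype.card d * θ) * (Real.sqrt Nξ * Real.sqrt Nξ) := by ring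
      _ = h * (Fintype.card d * θ) * Nξ := by rw [hx]
  have e2 : h * Real.sqrt Nδ * Real.sqrt Nξ ≤ h * (Fintype.card d * θ) * Nξ := by
    rw [mul_right_comm]; exact e1
  have e3 : h * Real.sqrt Nδ * Real.sqrt Nδ ≤ h * (Fintype.card d * θ) ^ 2 * Nξ := by
    rw [mul_assoc, hy, mul_assoc]
    exact mul_le_mul_of_nonneg_left hNδle hh
  calc |(∑ i, ∑ a, ∑ j, ∑ b, 𝔸 i a j b * ξ i a * δ j b) + (∑ i, ∑ a, ∑ j, ∑ b, 𝔸 i a j b * δ i a * ξ j b) +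
          ∑ i, ∑ a, ∑ j, ∑ b, 𝔸 i a j b * δ i a * δ j b|
        ≤ |∑ i, ∑ a, ∑ j, ∑ b, 𝔸 i a j b * ξ i a * δ j b| + |∑ i, ∑ a, ∑ j, ∑ b, 𝔸 i a j b * δ i a * ξ j b| +
          |∑ i, ∑ a, ∑ j, ∑ b, 𝔸 i a j b * δ i a * δ j b| := abs_add_three _ _ _
    _ ≤ h * (Fintype.card d * θ) * Nξ + h * (Fintype.card d * θ) * Nξ + h * (Fintype.card d * θ) ^ 2 * Nξ :=
        add_le_add (add_le_add (h1.trans e1) (h2.trans e2)) (h3.trans e3)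
    _ = h * (2 * (Fintype.card d * θ) + (Fintype.card d * θ) ^ 2) * Nξ := by ring

/-- **Twisted coercivity, relative form (lower)**: under a pointwise floor `λ‖ξ‖_F² ≤ gradForm 𝔸 ξ`, `λ > 0`,
`(1 − ε/λ)·gradForm 𝔸 ξ ≤ gradForm 𝔸^G ξ`, `ε = h(2dθ + (dθ)²)`.
[cite: Giaquinta1983MultipleIntegrals, Ch. III §2 eq. (2.2)] -/
theorem gradForm_conj_ge_of_floor {𝔸 : Visc4 d} {h : ℝ} (hB : FullBound 𝔸 h) (hh : 0 ≤ h) {G : Matrix d d ℝ}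
    {θ : ℝ} (hθ : 0 ≤ θ) (hG : ∀ c a, |G c a - (1 : Matrix d d ℝ) c a| ≤ θ) {lam : ℝ} (hlam : 0 < lam)
    (ξ : d → d → ℝ) (hfloor : lam * ∑ i, ∑ a, ξ i a ^ 2 ≤ gradForm 𝔸 ξ) :
    (1 - h * (2 * (Fintype.card d * θ) + (Fintype.card d * θ) ^ 2) / lam) * gradForm 𝔸 ξ ≤
      gradForm (Visc4.conj G 𝔸) ξ := by
  have habs := abs_gradForm_conj_sub_le hB hh hθ hG ξ
  set ε : ℝ := h * (2 * (Fintype.card d * θ) + (Fintype.card d * θ) ^ 2) with hε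
  have hε0 : 0 ≤ ε := by positivity
  have hlow := neg_le_of_abs_le habs
  have hN : ∑ i, ∑ a, ξ i a ^ 2 ≤ gradForm 𝔸 ξ / lam := by rw [le_div_iff₀ hlam, mul_comm]; exact hfloor
  have : ε / lam * gradForm 𝔸 ξ = ε * (gradForm 𝔸 ξ / lam) := by ring
  nlinarith [mul_le_mul_of_nonneg_left hN hε0]

/-- **Twisted coercivity, relative form (upper)**: under the same floor,
`gradForm 𝔸^G ξ ≤ (1 + ε/λ)·gradForm 𝔸 ξ`. [cite: Giaquinta1983MultipleIntegrals, Ch. III §2 eq. (2.2)] -/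
theorem gradForm_conj_le_of_floor {𝔸 : Visc4 d} {h : ℝ} (hB : FullBound 𝔸 h) (hh : 0 ≤ h) {G : Matrix d d ℝ}
    {θ : ℝ} (hθ : 0 ≤ θ) (hG : ∀ c a, |G c a - (1 : Matrix d d ℝ) c a| ≤ θ) {lam : ℝ} (hlam : 0 < lam)
    (ξ : d → d → ℝ) (hfloor : lam * ∑ i, ∑ a, ξ i a ^ 2 ≤ gradForm 𝔸 ξ) :
    gradForm (Visc4.conj G 𝔸) ξ ≤
      (1 + h * (2 * (Fintype.card d * θ) + (Fintype.card d * θ) ^ 2) / lam) * gradForm 𝔸 ξ := by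
  have habs := abs_gradForm_conj_sub_le hB hh hθ hG ξ
  set ε : ℝ := h * (2 * (Fintype.card d * θ) + (Fintype.card d * θ) ^ 2) with hε
  have hε0 : 0 ≤ ε := by positivity
  have hup := le_of_abs_le habs
  have hN : ∑ i, ∑ a, ξ i a ^ 2 ≤ gradForm 𝔸 ξ / lam := by rw [le_div_iff₀ hlam, mul_comm]; exact hfloor
  have : ε / lam * gradForm 𝔸 ξ = ε * (gradForm 𝔸 ξ / lam) := by ring
  nlinarith [mul_le_mul_of_nonneg_left hN hε0]

/-! ## §4 The scalar-viscosity instance -/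

/-- For the scalar viscosity `ν ≥ 0`: `FullBound (isoVisc ν) ((card d)² ν)` (entrywise criterion).
[cite: Giaquinta1983MultipleIntegrals, Ch. III §2 eq. (2.1)] -/
theorem fullBound_isoVisc {ν : ℝ} (hν : 0 ≤ ν) : FullBound (isoVisc ν : Visc4 d) ((Fintype.card d : ℝ) ^ 2 * ν) :=
  fullBound_of_entry_le fun i a j b => by
    unfold isoVisc
    split_ifs <;> simp [abs_of_nonneg hν, hν]

/-- **Scalar instance, lower**: `ν(1 − d²(2dθ + (dθ)²))‖ξ‖_F² ≤ gradForm (isoVisc ν)^G ξ` for `|G − 1| ≤ θ`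
entrywise (`d = card d`). [cite: ArmstrongVicol2025, §4.1 (s_{m−1}, T_{m−1}), PDF p. 34] -/
theorem gradForm_conj_isoVisc_ge {ν : ℝ} (hν : 0 < ν) {G : Matrix d d ℝ} {θ : ℝ} (hθ : 0 ≤ θ)
    (hG : ∀ c a, |G c a - (1 : Matrix d d ℝ) c a| ≤ θ) (ξ : d → d → ℝ) :
    ν * (1 - (Fintype.card d : ℝ) ^ 2 * (2 * (Fintype.card d * θ) + (Fintype.card d * θ) ^ 2)) * ∑ i, ∑ a, ξ i a ^ 2 ≤
      gradForm (Visc4.conj G (isoVisc ν)) ξ := by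
  have h := gradForm_conj_ge_of_floor (fullBound_isoVisc hν.le) (by positivity) hθ hG hν ξ
    (by rw [gradForm_isoVisc])
  rw [gradForm_isoVisc] at h
  have e : (1 - (Fintype.card d : ℝ) ^ 2 * ν * (2 * (Fintype.card d * θ) + (Fintype.card d * θ) ^ 2) / ν) *
      (ν * ∑ i, ∑ a, ξ i a ^ 2) =
      ν * (1 - (Fintype.card d : ℝ) ^ 2 * (2 * (Fintype.card d * θ) + (Fintype.card d * θ) ^ 2)) * ∑ i, ∑ a, ξ i a ^ 2 := by
    field_simp
  rw [e] at h
  exact h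

/-- **Scalar instance, upper**: `gradForm (isoVisc ν)^G ξ ≤ ν(1 + d²(2dθ + (dθ)²))‖ξ‖_F²`.
[cite: ArmstrongVicol2025, §4.1 (s_{m−1}, T_{m−1}), PDF p. 34] -/
theorem gradForm_conj_isoVisc_le {ν : ℝ} (hν : 0 < ν) {G : Matrix d d ℝ} {θ : ℝ} (hθ : 0 ≤ θ)
    (hG : ∀ c a, |G c a - (1 : Matrix d d ℝ) c a| ≤ θ) (ξ : d → d → ℝ) :
    gradForm (Visc4.conj G (isoVisc ν)) ξ ≤
      ν * (1 + (Fintype.card d : ℝ) ^ 2 * (2 * (Fintype.card d * θ) + (Fintype.card d * θ) ^ 2)) * ∑ i, ∑ a, ξ i a ^ 2 := by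
  have h := gradForm_conj_le_of_floor (fullBound_isoVisc hν.le) (by positivity) hθ hG hν ξ
    (by rw [gradForm_isoVisc])
  rw [gradForm_isoVisc] at h
  have e : (1 + (Fintype.card d : ℝ) ^ 2 * ν * (2 * (Fintype.card d * θ) + (Fintype.card d * θ) ^ 2) / ν) *
      (ν * ∑ i, ∑ a, ξ i a ^ 2) =
      ν * (1 + (Fintype.card d : ℝ) ^ 2 * (2 * (Fintype.card d * θ) + (Fintype.card d * θ) ^ 2)) * ∑ i, ∑ a, ξ i a ^ 2 := by
    field_simp
  rw [e] at h
  exact h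

end Literature.Analysis.FluidPDE.Torus
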